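import Summits.AnomalousDissipation.AnomalousDissipation.Theses.LimitingAbsorption
import Summits.AnomalousDissipation.AnomalousDissipation.Theorems.LimitingAbsorptionRelaxationBoundsInventorySuperposition
import Summits.AnomalousDissipation.AnomalousDissipation.Theorems.LimitingAbsorptionKinematicSteadySourceLawToolkit
import Literature.Analysis.FluidPDE.PassiveScalarExistenceProofs
import Literature.Analysis.FluidPDE.PassiveScalarForcedClass
import Literature.Analysis.FluidPDE.LongTimeAverageSlidingWindow
import Literature.Analysis.FunctionSpaces.SpaceTimeWeakCompactness

/-!
# Line `Sketch` — crux stmt-AnomalousDissipation-2940 (`RelaxationBoundsInventory`): skeleton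

Lead's skeleton (owned copy of `Cruxes/RelaxationBoundsInventory/SketchIdeator1.lean`, reshaped so
that the composition closes the crux BY NAME modulo registered `stub_*`).

THE LINE (card `phase-continuous-duhamel`, §"Why it bites here" (3): maximal reuse of the landed
Riemann–Duhamel superposition; only the step `N → ∞` was open). Fix a horizon `T > 0`.
* Releases `Θ_k` of the profile `h` at the grid phases `kδ`, `δ = T/(N+1)`, exist in the weak class
  (tree: `exists_isWeakScalarTransportOn_holds` + landed shift lemmas) and decay by `(U_h)`:
  `‖Θ_k(τ)‖ ≤ √C e^{-γτ/2} ‖h‖` (conversion `stub_eLpNormDecay`).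
* The superposition `W_N = ∑_k δ Λ_k` (landed: `LapInventory.ae_lintegral_sq_superposition_le`,
  `integral_superposition_mul_weakIntegrand`) is bounded in `L^∞_t L²_x` by
  `M_n = √C‖h‖(2/γ + T/(n+1))` for `N ≥ n` and solves the sourced weak identity with the Riemann-sum
  source `∑_k δ h ⊗ δ_{kδ}`.
* `N → ∞` (the open step): weak-* compactness in `L^∞_t L²_x` (tree:
  `exists_strictMono_weakLimit_of_lintegral_sq_le`) gives a limit `W`; the identity is LINEAR and the
  weak-form integrand is square integrable, so it passes to the limit, the source term by
  `stub_riemannSource` (Riemann sums of `t ↦ ∫ h ψ(t)`); `stub_forcedOfWeakIdentity` packages `W` as a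
  sourced weak solution from the zero datum with slice bound `M_n²`.
* Forced uniqueness for bounded drift (landed: `KinematicSteadySourceLaw.forced_ae_eq_of_memLp_top`)
  transfers the slice bound to THE given `θ` (`stub_sliceBoundTransfer`); `n → ∞` gives
  `scalarL2Sq (θ t) ≤ 4C/γ² · scalarL2Sq h` for a.e. `t ∈ (0,T)`, every `T`
  (`inventory_ae_le`), and an a.e. bound on `(0, ∞)` bounds the `limsup` of time means
  (`stub_longTimeAvgSupOfAe`). `RelaxationBoundsInventory_of` concludes the crux by name.

STUBS (tree vocabulary only; each lands verbatim as
`Theorems/LimitingAbsorptionRelaxationBoundsInventory<Stub>.lean --supports stmt-AnomalousDissipation-2940`):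
* S1 `stub_eLpNormDecay`        — `scalarL2Sq f ≤ C e^{-γt} scalarL2Sq h` ⇒ `‖f‖_{L²} ≤ √C e^{-γt/2} √(scalarL2Sq h)` [S]
* S2 `stub_riemannSource`       — `∑_{k ≤ N_j} δ_j ∫ h ψ(kδ_j) → ∫₀ᵀ∫ h ψ` as `N_j → ∞`            [S/M]
* S3 `stub_forcedOfWeakIdentity`— a measurable `L^∞_t L²_x` field satisfying the sourced weak
                                  identity (steady source `h ∈ L²`, zero datum, bounded div-free
                                  drift) IS a sourced weak solution                                [M]
* S4 `stub_sliceBoundTransfer`  — forced uniqueness ⇒ the slice bound of `W` is a slice bound of `θ` [S]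
* S5 `stub_longTimeAvgSupOfAe`  — a.e. bound on every `(0,T)` ⇒ bound on `longTimeAvgSup`          [S]
Composition (kernel-checked, no `sorry` outside the stubs): `exists_release`, `le_sq_of_forall`,
`inventory_ae_le`, `RelaxationBoundsInventory_of`.

DISPROOF USED: none exists yet (`payload.disproof_path` absent on disk 2026-08-16T10:30Z;
`ledger crux ls`: no `Disproof.lean`). Recorded why-might-fail honoured: no joint `(s,t)`
measurability is ever needed (finitely many releases per `N`; the limit is taken in `L²_{t,x}`),
only `L^∞` drift is used (uniqueness: landed `forced_ae_eq_of_memLp_top`).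
-/

noncomputable section

open MeasureTheory Set Filter Function TopologicalSpace Topology
open scoped ENNReal NNReal InnerProductSpace BigOperators

namespace Summit.AnomalousDissipation.AnomalousDissipation.Cruxes.RelaxationBoundsInventory.Sketch

set_option linter.dupNamespace false

open Literature.Analysis Literature.Analysis.FluidPDE Literature.Analysis.FluidPDE.Torus
open Summit.AnomalousDissipation.AnomalousDissipation.Theorems
open Summit.AnomalousDissipation.AnomalousDissipation.Theorems.LapInventory

variable {d : Type*} [Fintype d]

/-! ## S1 — decay in `eLpNorm` currency -/

/-- **S1 `stub_eLpNormDecay`.** For `f ∈ L²(T^d)` the relaxation bound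
`scalarL2Sq f ≤ C e^{-γ t} scalarL2Sq h` (`C ≥ 0`) reads, in `eLpNorm` currency,
`‖f‖_{L²} ≤ √C e^{-γt/2} √(scalarL2Sq h)` (`scalarL2Sq f = ‖f‖²_{L²}` for `f ∈ L²`,
`KinematicSteadySourceLaw.scalarL2Sq_eq_toReal_lintegral_and_lt_top`,
`FunctionSpaces.eLpNorm_two_pow_two_eq_lintegral`; square roots). [folklore] -/
theorem stub_eLpNormDecay {f h : UnitAddTorus d → ℝ} (hf : MemLp f 2 volume) {C γ t : ℝ}
    (hC : 0 ≤ C) (hle : scalarL2Sq f ≤ C * Real.exp (-(γ * t)) * scalarL2Sq h) :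
    eLpNorm f 2 volume ≤
      ENNReal.ofReal (Real.sqrt C * Real.exp (-(γ * t) / 2) * Real.sqrt (scalarL2Sq h)) := by
  sorry

/-! ## S2 — the Riemann-sum source term converges -/

/-- **S2 `stub_riemannSource`.** For `h ∈ L²(T^d)`, a space–time test function `ψ` on `[0,T)`,
`T > 0`, and step counts `N_j → ∞`, the Riemann-sum source terms of the superpositions converge:
`∑_{k ≤ N_j} δ_j ∫ h ψ(kδ_j) → ∫_{(0,T)} ∫ h ψ(t)`, `δ_j = T/(N_j+1)` (`t ↦ ∫ h ψ(t)` is continuous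
on `[0,T]` by dominated convergence; landed `LapInventory.tendsto_riemann_sum`; the interval
integral over `[0,T]` is the set integral over `(0,T)`). [folklore] -/
theorem stub_riemannSource {T : ℝ} (hT : 0 < T) {h : UnitAddTorus d → ℝ} (hh : MemLp h 2 volume)
    {ψ : ℝ → UnitAddTorus d → ℝ} (hψ : FunctionSpaces.Torus.IsSpaceTimeTest T ψ)
    {Nf : ℕ → ℕ} (hN : Tendsto Nf atTop atTop) :
    Tendsto (fun j => ∑ k ∈ Finset.range (Nf j + 1),
        T / (Nf j + 1) * ∫ x, h x * ψ (k * (T / (Nf j + 1))) x) atTop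
      (𝓝 (∫ t in Ioo 0 T, ∫ x, h x * ψ t x)) := by
  sorry

/-! ## S3 — a field satisfying the sourced weak identity is a sourced weak solution -/

/-- **S3 `stub_forcedOfWeakIdentity`.** Let `u ∈ L^∞((0,T) × T^d)` be weakly divergence free at
a.e. time, `h ∈ L²(T^d)`, and let `W` be a space–time field with measurable lift and
`∫ |W(t)|² ≤ B` for a.e. `t ∈ (0,T)` which satisfies the sourced weak identity with the steady
source `h` and zero datum, `∫₀ᵀ∫ W (∂ₜψ + u·∇ψ + κΔψ) = -∫₀ᵀ∫ h ψ` for every space–time test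
function `ψ` on `[0,T)`. Then `W` is a weak solution of `∂ₜW + u·∇W = κΔW + h` from the zero
datum in the sense of `Torus.IsWeakScalarTransportForcedOn` (the remaining conjuncts —
`u ∈ L¹_t L²_x`, `uW ∈ L¹`, `h ∈ L¹_{t,x}` — follow from boundedness of `u`, the slice bound and
`T < ∞`; template: `IsWeakScalarTransportOn.of_tendsto`). [folklore] -/
theorem stub_forcedOfWeakIdentity {T κ : ℝ} {u : ℝ → UnitAddTorus d → EuclideanSpace ℝ d}
    (hu : MemLp (FunctionSpaces.Torus.stLift u) ⊤ (volume.restrict (Ioo 0 T ×ˢ univ)))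
    (hdiv : ∀ᵐ t ∂(volume.restrict (Ioo 0 T)), FunctionSpaces.Torus.IsWeaklyDivFree (u t))
    {h : UnitAddTorus d → ℝ} (hh : MemLp h 2 volume)
    {W : ℝ → UnitAddTorus d → ℝ}
    (hWm : AEStronglyMeasurable (FunctionSpaces.Torus.stLift W) (volume.restrict (Ioo 0 T ×ˢ univ)))
    {B : ℝ≥0} (hWb : ∀ᵐ t ∂(volume.restrict (Ioo 0 T)), ∫⁻ x, ‖W t x‖ₑ ^ 2 ≤ B)
    (hWeq : ∀ ψ : ℝ → UnitAddTorus d → ℝ, FunctionSpaces.Torus.IsSpaceTimeTest T ψ →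
      (∫ t in Ioo 0 T, ∫ x, W t x *
          (FunctionSpaces.Torus.timeDeriv ψ t x + ⟪u t x, FunctionSpaces.Torus.gradient (ψ t) x⟫_ℝ +
            κ * FunctionSpaces.Torus.laplacian (ψ t) x)) =
        -∫ t in Ioo 0 T, ∫ x, h x * ψ t x) :
    IsWeakScalarTransportForcedOn T κ u (fun _ => h) 0 W := by
  sorry

/-! ## S4 — forced uniqueness transfers the slice bound -/

/-- **S4 `stub_sliceBoundTransfer`.** For `κ > 0` and a drift `u ∈ L^∞((0,T) × T^d)`, two sourced
weak solutions with the same source and datum agree at a.e. time (landed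
`KinematicSteadySourceLaw.forced_ae_eq_of_memLp_top`), so a slice bound `∫ |W(t)|² ≤ B` of one is
the bound `scalarL2Sq (θ t) ≤ B` of the other, for a.e. `t ∈ (0,T)` (`θ(t) ∈ L²` a.e.,
`IsWeakScalarTransportForcedOn.ae_memLp_two`). [folklore] -/
theorem stub_sliceBoundTransfer {T κ : ℝ} (hκ : 0 < κ) {u : ℝ → UnitAddTorus d → EuclideanSpace ℝ d}
    (hu : MemLp (FunctionSpaces.Torus.stLift u) ⊤ (volume.restrict (Ioo 0 T ×ˢ univ)))
    {s : ℝ → UnitAddTorus d → ℝ} {θ₀ : UnitAddTorus d → ℝ} {θ W : ℝ → UnitAddTorus d → ℝ}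
    (hθ : IsWeakScalarTransportForcedOn T κ u s θ₀ θ) (hW : IsWeakScalarTransportForcedOn T κ u s θ₀ W)
    {B : ℝ≥0} (hWb : ∀ᵐ t ∂(volume.restrict (Ioo 0 T)), ∫⁻ x, ‖W t x‖ₑ ^ 2 ≤ B) :
    ∀ᵐ t ∂(volume.restrict (Ioo 0 T)), scalarL2Sq (θ t) ≤ (B : ℝ) := by
  sorry

/-! ## S5 — an a.e. bound on `(0, ∞)` bounds the long-time average -/

omit [Fintype d] in
/-- **S5 `stub_longTimeAvgSupOfAe`.** If `g ≥ 0` everywhere and `g ≤ K` a.e. on every `(0,T)`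
(`K ≥ 0`), then `longTimeAvgSup g ≤ K`: each running mean is `≤ K` (a non-integrable `g` has
running mean `0 ≤ K`), and `longTimeAvgSup_le_of_eventually_le`. [folklore] -/
theorem stub_longTimeAvgSupOfAe {g : ℝ → ℝ} {K : ℝ} (hg : ∀ t, 0 ≤ g t) (hK : 0 ≤ K)
    (hle : ∀ T : ℝ, 0 < T → ∀ᵐ t ∂(volume.restrict (Ioo 0 T)), g t ≤ K) :
    longTimeAvgSup g ≤ K := by
  sorry

/-! ## Composition (no `sorry` below this line) -/

/-- **Releases exist at every phase.** For `κ > 0`, a drift bounded and a.e. weakly divergence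
free on `(0,T) × T^d` and a profile `h ∈ L²`, the homogeneous problem with the shifted drift
`u(a + ·)` and datum `h` has a weak solution on `[0, T - a)` for every `a ≥ 0` (tree existence
`exists_isWeakScalarTransportOn_holds` after the landed shift lemmas). [folklore] -/
theorem exists_release {T κ : ℝ} (hκ : 0 < κ) {u : ℝ → UnitAddTorus d → EuclideanSpace ℝ d}
    (hu : MemLp (FunctionSpaces.Torus.stLift u) ⊤ (volume.restrict (Ioo 0 T ×ˢ univ)))
    (hdiv : ∀ᵐ t ∂(volume.restrict (Ioo 0 T)), FunctionSpaces.Torus.IsWeaklyDivFree (u t))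
    {h : UnitAddTorus d → ℝ} (hh : MemLp h 2 volume) {a : ℝ} (ha : 0 ≤ a) :
    ∃ Θ : ℝ → UnitAddTorus d → ℝ, IsWeakScalarTransportOn (T - a) κ (fun t => u (a + t)) h Θ := by
  obtain ⟨Θ, hΘ, -⟩ := exists_isWeakScalarTransportOn_holds hκ hh
    (memLp_top_stLift_comp_const_add ha hu)
    (ae_restrict_Ioo_comp_const_add ha (P := fun t => FunctionSpaces.Torus.IsWeaklyDivFree (u t)) hdiv)
  exact ⟨Θ, hΘ⟩

omit [Fintype d] in
/-- If `x ≤ (a + b/(n+1))²` for every `n : ℕ`, then `x ≤ a²` (let `n → ∞`). [folklore] -/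
theorem le_sq_of_forall {x a b : ℝ}
    (h : ∀ n : ℕ, x ≤ (a + b / (n + 1)) ^ 2) : x ≤ a ^ 2 := by
  have hlim : Tendsto (fun n : ℕ => (a + b / (n + 1)) ^ 2) atTop (𝓝 ((a + 0) ^ 2)) := by
    have h1 : Tendsto (fun n : ℕ => b / ((n : ℝ) + 1)) atTop (𝓝 0) :=
      tendsto_const_nhds.div_atTop (tendsto_natCast_atTop_atTop.atTop_add tendsto_const_nhds)
    exact (tendsto_const_nhds.add h1).pow 2
  rw [add_zero] at hlim
  exact ge_of_tendsto' hlim fun n => h n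

/-- **The inventory bound on every finite horizon.** Under the hypotheses of the crux, for every
`T > 0`: `scalarL2Sq (θ t) ≤ 4C/γ² · scalarL2Sq h` for a.e. `t ∈ (0,T)` (the composition described
in the module docstring). [folklore] -/
theorem inventory_ae_le (κ : ℝ) (u : ℝ → UnitAddTorus (Fin 2) → EuclideanSpace ℝ (Fin 2))
    (h : UnitAddTorus (Fin 2) → ℝ) (C γ : ℝ) (hκ : 0 < κ) (hC : 0 ≤ C) (hγ : 0 < γ)
    (hh : MemLp h 2 volume)
    (hu : ∀ T : ℝ, 0 < T →
      MemLp (FunctionSpaces.Torus.stLift u) ⊤ (volume.restrict (Ioo (0 : ℝ) T ×ˢ univ)))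
    (hU : ∀ s : ℝ, 0 ≤ s → ∀ (T : ℝ) (θ : ℝ → UnitAddTorus (Fin 2) → ℝ),
      IsWeakScalarTransportOn T κ (fun t => u (s + t)) h θ →
        ∀ᵐ t ∂(volume.restrict (Ioo (0 : ℝ) T)),
          scalarL2Sq (θ t) ≤ C * Real.exp (-(γ * t)) * scalarL2Sq h)
    (θ : ℝ → UnitAddTorus (Fin 2) → ℝ) (hθ : IsWeakScalarTransportForced κ u (fun _ => h) 0 θ)
    {T : ℝ} (hT : 0 < T) :
    ∀ᵐ t ∂(volume.restrict (Ioo (0 : ℝ) T)), scalarL2Sq (θ t) ≤ 4 * C / γ ^ 2 * scalarL2Sq h := by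
  have huT := hu T hT
  have hθT : IsWeakScalarTransportForcedOn T κ u (fun _ => h) 0 θ := hθ T hT
  have hdiv := hθT.ae_isWeaklyDivFree
  set A : ℝ := Real.sqrt C with hA
  set σ : ℝ := Real.sqrt (scalarL2Sq h) with hσ
  have hA0 : 0 ≤ A := Real.sqrt_nonneg _
  have hσ0 : 0 ≤ σ := Real.sqrt_nonneg _
  -- releases at all grid phases, for every `N`
  have hrel : ∀ N k : ℕ, ∃ Θ : ℝ → UnitAddTorus (Fin 2) → ℝ,
      IsWeakScalarTransportOn (T - k * (T / (N + 1))) κ (fun t => u (k * (T / (N + 1)) + t)) h Θ := by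
    intro N k
    exact exists_release hκ huT hdiv hh (by positivity)
  choose Θ hΘ using hrel
  -- their decay, from `(U_h)`, in `eLpNorm` currency
  have hbd : ∀ N k : ℕ, ∀ᵐ τ ∂((volume : Measure ℝ).restrict (Ioo 0 (T - k * (T / (N + 1))))),
      eLpNorm (Θ N k τ) 2 volume ≤ ENNReal.ofReal (A * Real.exp (-(γ * τ) / 2) * σ) := by
    intro N k
    have h1 := hU (k * (T / (N + 1))) (by positivity) (T - k * (T / (N + 1))) (Θ N k) (hΘ N k)
    filter_upwards [h1, (hΘ N k).ae_memLp_two] with τ hτ hm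
    exact stub_eLpNormDecay hm hC hτ
  -- the superpositions `W_N`
  set Wsup : ℕ → ℝ → UnitAddTorus (Fin 2) → ℝ := fun N t x => ∑ k ∈ Finset.range (N + 1),
    T / (N + 1) * (if (k : ℝ) * (T / (N + 1)) < t then Θ N k (t - k * (T / (N + 1))) x else 0) with hWsup
  have hWm : ∀ N, AEStronglyMeasurable (FunctionSpaces.Torus.stLift (Wsup N))
      (volume.restrict (Ioo 0 T ×ˢ univ)) := fun N =>
    FunctionSpaces.Torus.aestronglyMeasurable_stLift_of_uncurry
      (aestronglyMeasurable_uncurry_superposition hT.le (hΘ N))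
  have hWeq : ∀ N, ∀ ψ : ℝ → UnitAddTorus (Fin 2) → ℝ, FunctionSpaces.Torus.IsSpaceTimeTest T ψ →
      (∫ t in Ioo 0 T, ∫ x, Wsup N t x *
          (FunctionSpaces.Torus.timeDeriv ψ t x + ⟪u t x, FunctionSpaces.Torus.gradient (ψ t) x⟫_ℝ +
            κ * FunctionSpaces.Torus.laplacian (ψ t) x)) =
        -∑ k ∈ Finset.range (N + 1), T / (N + 1) * ∫ x, h x * ψ (k * (T / (N + 1))) x :=
    fun N ψ hψ => integral_superposition_mul_weakIntegrand hT huT (hΘ N) hψ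
  -- slice bound `M_n` for `N ≥ n`, and the bound for a.e. `t` obtained from the tail `N ≥ n`
  have hmain : ∀ n : ℕ, ∀ᵐ t ∂(volume.restrict (Ioo (0 : ℝ) T)),
      scalarL2Sq (θ t) ≤ (A * σ * (2 / γ + T / (n + 1))) ^ 2 := by
    intro n
    set M : ℝ := A * σ * (2 / γ + T / (n + 1)) with hM
    have hM0 : 0 ≤ M := by positivity
    set B : ℝ≥0 := M.toNNReal ^ 2 with hB
    -- the tail sequence `F j = W_{n+j}`
    set F : ℕ → ℝ → UnitAddTorus (Fin 2) → ℝ := fun j => Wsup (n + j) with hF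
    have hFb : ∀ j, ∀ᵐ t ∂(volume.restrict (Ioo (0 : ℝ) T)), ∫⁻ x, ‖F j t x‖ₑ ^ 2 ≤ B := by
      intro j
      have hMj : A * σ * (2 / γ + T / ((n + j : ℕ) + 1)) ≤ M := by
        rw [hM]
        refine mul_le_mul_of_nonneg_left (add_le_add le_rfl ?_) (mul_nonneg hA0 hσ0)
        refine div_le_div_of_nonneg_left hT.le (by positivity) ?_
        push_cast
        linarith [(Nat.cast_nonneg j : (0 : ℝ) ≤ j)]
      exact ae_lintegral_sq_superposition_le hT hγ hA0 hσ0 (hΘ (n + j)) (hbd (n + j)) hMj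
    -- weak-* limit of the tail
    obtain ⟨φ, hφ, W, hWm', hWb, hlim⟩ :=
      FunctionSpaces.Torus.exists_strictMono_weakLimit_of_lintegral_sq_le (fun j => hWm (n + j)) hFb
    -- the weak identity passes to the limit
    have hWid : ∀ ψ : ℝ → UnitAddTorus (Fin 2) → ℝ, FunctionSpaces.Torus.IsSpaceTimeTest T ψ →
        (∫ t in Ioo 0 T, ∫ x, W t x *
            (FunctionSpaces.Torus.timeDeriv ψ t x + ⟪u t x, FunctionSpaces.Torus.gradient (ψ t) x⟫_ℝ +
              κ * FunctionSpaces.Torus.laplacian (ψ t) x)) =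
          -∫ t in Ioo 0 T, ∫ x, h x * ψ t x := by
      intro ψ hψ
      obtain ⟨-, hGm, -, hG2⟩ := exists_bound_weakIntegrand (κ := κ) huT hψ
      have h1 := hlim _ (FunctionSpaces.Torus.aestronglyMeasurable_stLift_of_uncurry hGm) hG2
      have h2 : Tendsto (fun j => ∫ t in Ioo 0 T, ∫ x, Wsup (n + φ j) t x *
            (FunctionSpaces.Torus.timeDeriv ψ t x + ⟪u t x, FunctionSpaces.Torus.gradient (ψ t) x⟫_ℝ +
              κ * FunctionSpaces.Torus.laplacian (ψ t) x)) atTop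
          (𝓝 (-∫ t in Ioo 0 T, ∫ x, h x * ψ t x)) := by
        have hN : Tendsto (fun j => n + φ j) atTop atTop :=
          tendsto_atTop_mono (fun j => Nat.le_add_left _ _) hφ.tendsto_atTop
        have h3 := (stub_riemannSource hT hh hψ hN).neg
        refine h3.congr fun j => ?_
        exact (hWeq (n + φ j) ψ hψ).symm
      exact tendsto_nhds_unique h1 h2
    -- `W` is a sourced weak solution from the zero datum, with slice bound `B`
    have hW : IsWeakScalarTransportForcedOn T κ u (fun _ => h) 0 W :=
      stub_forcedOfWeakIdentity huT hdiv hh hWm' hWb hWid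
    -- forced uniqueness: the bound is a bound for `θ`
    have h4 := stub_sliceBoundTransfer hκ huT hθT hW hWb
    filter_upwards [h4] with t ht
    refine ht.trans (le_of_eq ?_)
    rw [hB, NNReal.coe_pow, Real.coe_toNNReal _ hM0]
  -- `n → ∞`
  have hall := ae_all_iff.2 hmain
  filter_upwards [hall] with t ht
  have h5 : scalarL2Sq (θ t) ≤ (A * σ * (2 / γ)) ^ 2 := by
    refine le_sq_of_forall (b := A * σ * T) fun n => ?_
    have e : A * σ * (2 / γ) + A * σ * T / (n + 1) = A * σ * (2 / γ + T / (n + 1)) := by ring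
    rw [e]
    exact ht n
  calc scalarL2Sq (θ t) ≤ (A * σ * (2 / γ)) ^ 2 := h5
    _ = 4 * C / γ ^ 2 * scalarL2Sq h := by
        rw [hA, hσ, mul_pow, mul_pow, Real.sq_sqrt hC, Real.sq_sqrt (scalarL2Sq_nonneg h)]
        field_simp
        ring

/-- **The composition: `RelaxationBoundsInventory` from the stubs** (concludes the crux BY NAME;
the only `sorry`s are inside `stub_*`). [folklore] -/
theorem RelaxationBoundsInventory_of :
    Summit.AnomalousDissipation.AnomalousDissipation.Theses.LimitingAbsorption.RelaxationBoundsInventory := by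
  intro κ u h C γ hκ hC hγ hh hu hU θ hθ
  refine stub_longTimeAvgSupOfAe (fun t => scalarL2Sq_nonneg _)
    (mul_nonneg (div_nonneg (by positivity) (by positivity)) (scalarL2Sq_nonneg h)) fun T hT => ?_
  exact inventory_ae_le κ u h C γ hκ hC hγ hh hu hU θ hθ hT

end Summit.AnomalousDissipation.AnomalousDissipation.Cruxes.RelaxationBoundsInventory.Sketch

end
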